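import Summits.QuantumFields.YangMills.Theorems.BalabanUVNodesN22KernelFadingAgeWeighted
import Summits.QuantumFields.YangMills.Theorems.BalabanUVNodesN22KnitRecursion

/-!
# BalabanUVNodes ∕ node N22 = NE9 — THE RECURSION-CURRENCY EDITION AT THE RECORD: K3's `h9` WITH THE RECORD's GEOMETRIC MODULI from node N18's kernel step rate + the
# FIRST- and SECOND-ORDER STEP INEQUALITIES of the renormalization recursion on the kernel functional of record (pub-balaban's `StepLipschitz`, dag-n22-a's (S2-last)∕(S2-old)),
# with NO smallness of the recursion's growth `ω₁ + c` — only the row `ℓ.θ₅·ν ≤ ℓ.ω²` against N18's rate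

Cell `pub-ymgap`, HUMAN RULING D-0062 (Track A), R134 seat `pub-ymgap-dag-n22-c` (strategy s1), generation 16, module J50.  THEOREMS ONLY (no `def`, no `sorry`, standard axioms);
`--kind proof --supports stmt-QuantumFields-27366 --as helper` (K3⁸ `SpineGivenEndpointR13SepCoPHV`, skeleton v6 — §2b N22 face `h9` verbatim), COUNT-NEUTRAL.  Imports module J48
`…N22KernelFadingAgeWeighted` (through it J38's (P)∕(O) lemmas and `ne9_mono`, dag-n22-w3's pin face) and dag-n22-a's `…N22KnitRecursion` (`ne9_and_fadingMemory_of_osc_stepSecondDiff`;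
through it pub-balaban's `T4HistoryLipschitzRecursion` and `T4CouplingAnalyticity`).  Nothing re-declared; every step is plain application.

WHY.  Module J48 restored ROAD 2's growth letter at the record: K3's `h9` follows from N18's kernel step rate + second differences GROWING like `q^{age}` under `ℓ.θ₅·q ≤ ℓ.ω²`.  The
in-tree MECHANISM producing such second differences for the OLDER coordinates is the renormalization recursion itself, typed on the abstract output carriers by pub-balaban's seat
NE9-P2 (`T4HistoryLipschitzRecursion.StepLipschitz`: the term created at step `k + 1` is Lipschitz in its LAST coupling, constant `lam k ≤ ℓ₁`, and in the previously created terms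
through a linear channel `a k j ≤ c·ω₁^{k−j}` — [I] (2.13)'s curly bracket) and at second order by dag-n22-a (`N22KnitRecursion`: (S2-last) second differences in the last coupling
`≤ lam₂ k·d²·e^{−κd}`, `lam₂ ≤ ℓ₂`; (S2-old) the chain rule through the curly bracket — the linear channel `a` on second differences of the old terms plus the tilted-VARIANCE channel
`b k j ≤ c_b·ω₁^{k−j}` on squares of their first differences).  ROAD 1 (`ne9_of_stepLipschitz`) turns `StepLipschitz` into first-order moduli `ℓ₁(ω₁ + c)^{age}` with NO smallness;
dag-n22-a's `secondDiff_of_stepSecondDiff` turns those + (S2-last) + (S2-old) into second differences `L₂·ν^{age}` for every `ν > ω₁ + c`, `ν ≥ (ω₁ + c)²`, again with NO smallness;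
J48's knit then needs only N18's rate against that growth.  THIS FILE composes the three at the record:
* §1 ★★ `ne9_and_fadingMemory_of_osc_stepLipschitz_stepSecondDiff` — on ABSTRACT carriers: (P) + (O) at rate `θ` + `ScaleZeroFree` + `StepLipschitz` + (S2-last) + (S2-old) + channel
  weights ⟹ `NE9 E (Window γ) κ (C₉τ^{k−i}) ∧ FadingMemory C₉ τ _` for every `ν > ω₁ + c`, `ν ≥ (ω₁ + c)²` and `ρ ∈ ]0,1]`, `τ > 0` with `θ ≤ τρ`, `νρ ≤ τ`
  (`C₉ = (4C₀∕γ + L₂γ∕2)∕τ`, `L₂ = max ℓ₂ (c_b ℓ₁²∕(ν − ω₁ − c))`) — dag-n22-a's `ne9_and_fadingMemory_of_osc_stepSecondDiff` with its (L1) DISCHARGED by ROAD 1 read without smallness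
  (`ne9_of_stepLipschitz` ∘ `renewalSuper_geometric` ∘ `coordLipschitzOn_of_ne9`).
* §2 ★★★ `ne9_EA_objectsOfRecord₁₃_of_kernelStepRate_stepRecursion` — AT THE RECORD: node N18's `KernelStepRateOfRecord₁₃ F N θ κ ℓ.θ₅ C₅` + the uniform kernel decay + `StepLipschitz`,
  (S2-last), (S2-old) ON THE KERNEL FUNCTIONAL OF RECORD `(objectsOfRecord₁₃ F N θ ℓ).EA 0` + channel weights + the rows `ω₁ + c < ν`, `(ω₁ + c)² ≤ ν`, `1 ≤ ν`, `0 < ℓ.ω`,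
  **`ℓ.θ₅·ν ≤ ℓ.ω²`**, `ℓ.κ ≤ κ`, `(4·(2C₅∕(1−ℓ.θ₅) + 2E₀)∕θ.γ + L₂·θ.γ∕2)∕ℓ.ω ≤ ℓ.C₉` ⟹ **`NE9 ((objectsOfRecord₁₃ F N θ ℓ).EA 0) (Window θ.γ) ℓ.κ ℓ.moduli`**.  NO smallness of
  `ω₁ + c`; NO coupling disc, sector or chart; NO term tower, reading or law (the schemas are stated on the limiting kernels of record directly).
* §3 ★★★ the pin face `n22At_rateCarriers_of_kernels_pin_of_kernelStepRate_stepRecursion` (every `k`, under `hpin`).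
THE N22 ROW SENTENCE in recursion currency: «N18's kernel step rate + the first- and second-order Lipschitz structure of the step map {last coupling, old terms} ↦ new term with
geometrically weighted channels ⇒ K3's `h9` with the record's GEOMETRIC moduli, whenever N18's rate beats the recursion's growth: `θ₅·max(ν) < ω²`».

HONEST FRAMING (binding).  Count-neutral COMPOSITION of landed theorems by name; NO estimate of Bałaban's is proved or asserted.  `StepLipschitz`, (S2-last), (S2-old) and the channel
weights are HYPOTHESIS SHAPES (cell NEW ESTIMATES, NOT PRINTED — pub-balaban GAPS G-t4-U3-1∕-3; [I] prints the recursion (0.23) p. 256, (2.12)–(2.13) p. 268 and the last-coupling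
C^∞ clause p. 263 without constants, and «depends also on all preceding coupling constants» p. 298); here they are displayed ON THE LIMITING KERNELS OF RECORD (a producer would derive
them from TERM-level step schemas through W1-20's law, the windows and (1.21) — node N10 ∕ NODE A ∕ def-W1's generator; not typed here); N18's kernel step rate is node N18's (NE5 NOT
PRINTED for d = 4); nothing of the record is constructed or claimed to meet the displayed inputs; the schemas are met by the history-free functional (A5: content = the composition's
shape, conditional).  N22 is NOT discharged (typed 28∕28 · discharged 5∕27 UNCHANGED); K3⁸ OPEN and NOT claimed (no stub of 27366 touched); NE9 is NOT IN PRINT for d = 4; no count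
claim; one finite 𝕋⁴ programme at fixed ε — R4 closes the CONDITIONAL rung `BalabanLadder.UV` only; NOTHING about the continuum limit, ℝ⁴, infinite volume, OS axioms, a mass gap or
the Clay problem is proved or claimed.  References (TYPES only, no cite tags on the Summit side): [I] = Bałaban, CMP 109 (1987) Thm 1 p. 259, (0.23) p. 256, §1 p. 263 with (1.18),
(1.20)–(1.22) p. 264, (2.12)–(2.13) p. 268, §3 p. 270, §5 p. 298; [II] = CMP 116 (1988) Lemma 1 (1.33)–(1.36) pp. 7–9, (2.13)–(2.14) pp. 14–15; King, CMP 102 (1986) Lemma 4.5.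
-/

noncomputable section

open Filter Topology Set Metric
open scoped BigOperators

namespace YMDAG.N22.KernelFading

open Literature.MathematicalPhysics.QuantumFieldTheory.Balaban1983to89
open Literature.MathematicalPhysics.QuantumFieldTheory.Balaban1983to89.T4Continuum (T4Family ULoop)
open Literature.MathematicalPhysics.QuantumFieldTheory.Balaban1983to89.T4OutputRate (Carriers Functional Window NE9 FadingMemory DecayBound PrefixDependenceOn)
open Literature.MathematicalPhysics.QuantumFieldTheory.Balaban1983to89.T4HistoryLipschitzRecursion (ScaleZeroFree StepLipschitz ne9_of_stepLipschitz renewalSuper_geometric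
  prodModuli prodModuli_const)
open Literature.MathematicalPhysics.QuantumFieldTheory.Balaban1983to89.T4CouplingAnalyticity (BoxWindow coordLipschitzOn_of_ne9)
open Literature.MathematicalPhysics.QuantumFieldTheory.Balaban1983to89.B12Sec2to5 (l1)
open Literature.MathematicalPhysics.QuantumFieldTheory.Balaban1983to89.Node00 (mergedTermFamilyMatT TβOfRecord₁₃ chiβOfRecord₁₃ Stage13Params Stage13HParams U3Letters₁₁)
open Literature.MathematicalPhysics.QuantumFieldTheory.Balaban1983to89.Node00.U3OfKernels (carriers kernelA EA objectsOfRecord₁₃ EA_apply)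
open Literature.MathematicalPhysics.QuantumFieldTheory.Balaban1983to89.Node00.U3KernelLetters (KernelStepRate KernelStepRateOfRecord₁₃ PolLimitsExistOfRecord₁₃)
open Summit.QuantumFields.YangMills.BalabanUVNodes.N22KnitRecursion (ne9_and_fadingMemory_of_osc_stepSecondDiff)
open YMDAG.UVSplit (N22At RateReading₁₃CoPH rateCarriersOfRecord₁₃CoPH)
open YMDAG.N22.AtKernels (n22At_rateCarriers_of_kernels_pin_of_ne9)

open scoped Matrix.Norms.L2Operator

/-! ## §1 Abstract carriers: (P) + (O) + the first- and second-order step inequalities ⟹ node N22's pair, NO smallness of `ω₁ + c` -/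

section Abstract

open Finset in
/-- ★★ **NODE N22's PAIR FROM (P) + (O) + `StepLipschitz` + THE SECOND-ORDER STEP RECURSION, NO SMALLNESS.**  On abstract output carriers: (P) prefix dependence; (O) oscillation
fading at rate `θ` (`C₀ ≥ 0`; = tower-NE5, node N18 along the tower); `ScaleZeroFree`; `StepLipschitz E (Window γ) κ lam a` with `lam ≤ ℓ₁` (ROAD 1's one per-step inequality);
(S2-last) second differences in the last coupling `≤ lam₂ k·d²·e^{−κd}`, `lam₂ ≤ ℓ₂`; (S2-old) dag-n22-a's second-order step inequality with the SAME linear channel `a` and a variance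
channel `b`; weights `0 ≤ a k j ≤ c·ω₁^{k−j}`, `0 ≤ b k j ≤ c_b·ω₁^{k−j}`; a growth rate `ν` with `ω₁ + c < ν`, `(ω₁ + c)² ≤ ν`; `ρ ∈ ]0, 1]`, `τ > 0` with `θ ≤ τρ`, `νρ ≤ τ` ⟹
**`NE9 E (Window γ) κ Λ₁ ∧ FadingMemory C₉ τ Λ₁`**, `Λ₁ k i = C₉·τ^{k−i}`, `C₉ = (4C₀∕γ + L₂γ∕2)∕τ`, `L₂ = max ℓ₂ (c_b ℓ₁²∕(ν − ω₁ − c))` — dag-n22-a's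
`N22KnitRecursion.ne9_and_fadingMemory_of_osc_stepSecondDiff` with its first-order moduli (L1) `ℓ₁(ω₁ + c)^{age}` DISCHARGED from `StepLipschitz` by ROAD 1 read WITHOUT its smallness
clause (`ne9_of_stepLipschitz` ∘ `renewalSuper_geometric` ∘ `prodModuli_const` ∘ `coordLipschitzOn_of_ne9`).  Fading available iff `θν < 1`. [folklore] -/
theorem ne9_and_fadingMemory_of_osc_stepLipschitz_stepSecondDiff {C : Carriers} {Bg : Type} {E : Functional C Bg}
    {γ κ C₀ θ ℓ₁ ℓ₂ c cb ω₁ ν ρ τ : ℝ} {lam lam₂ : ℕ → ℝ} {a b : ℕ → ℕ → ℝ}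
    (hP : PrefixDependenceOn E (Window γ))
    (hO : ∀ g ∈ Window γ, ∀ g' ∈ Window γ, ∀ (U : Bg) (X : C.Dom) (m : ℕ), m ≤ C.scale X →
      (∀ n, m ≤ n → g n = g' n) → |E g U X - E g' U X| ≤ C₀ * θ ^ (C.scale X - m) * Real.exp (-(κ * C.d X)))
    (h0 : ScaleZeroFree E (Window γ)) (hS1 : StepLipschitz E (Window γ) κ lam a) (hlam : ∀ k, lam k ≤ ℓ₁) (hℓ₁ : 0 ≤ ℓ₁)
    (hS2last : ∀ g ∈ Window γ, ∀ (k : ℕ) (t d : ℝ), 0 < d → t - d ∈ Set.Ioc (0 : ℝ) γ → t + d ∈ Set.Ioc (0 : ℝ) γ →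
      ∀ (U : Bg) (X : C.Dom), C.scale X = k + 1 →
        |E (Function.update g k (t + d)) U X - 2 * E (Function.update g k t) U X + E (Function.update g k (t - d)) U X| ≤
          Real.exp (-(κ * C.d X)) * (lam₂ k * d ^ 2))
    (hS2old : ∀ g ∈ Window γ, ∀ (i : ℕ) (t d : ℝ), 0 < d → t - d ∈ Set.Ioc (0 : ℝ) γ → t + d ∈ Set.Ioc (0 : ℝ) γ →
      ∀ (D₁ D₂ : ℕ → ℝ) (k : ℕ), i < k →
        (∀ (U' : Bg) (X' : C.Dom), C.scale X' ≤ k →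
          |E (Function.update g i (t + d)) U' X' - E (Function.update g i t) U' X'| ≤ Real.exp (-(κ * C.d X')) * D₁ (C.scale X') ∧
          |E (Function.update g i t) U' X' - E (Function.update g i (t - d)) U' X'| ≤ Real.exp (-(κ * C.d X')) * D₁ (C.scale X') ∧
          |E (Function.update g i (t + d)) U' X' - 2 * E (Function.update g i t) U' X' + E (Function.update g i (t - d)) U' X'| ≤
            Real.exp (-(κ * C.d X')) * D₂ (C.scale X')) →
        ∀ (U : Bg) (X : C.Dom), C.scale X = k + 1 →
          |E (Function.update g i (t + d)) U X - 2 * E (Function.update g i t) U X + E (Function.update g i (t - d)) U X| ≤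
            Real.exp (-(κ * C.d X)) * ∑ j ∈ range (k + 1), (a k j * D₂ j + b k j * D₁ j ^ 2))
    (ha : ∀ k j, j ≤ k → 0 ≤ a k j ∧ a k j ≤ c * ω₁ ^ (k - j)) (hb : ∀ k j, j ≤ k → 0 ≤ b k j ∧ b k j ≤ cb * ω₁ ^ (k - j))
    (hlam₂ : ∀ k, lam₂ k ≤ ℓ₂) (hℓ₂ : 0 ≤ ℓ₂) (hc : 0 ≤ c) (hcb : 0 ≤ cb) (hω₁ : 0 ≤ ω₁) (hν : ω₁ + c < ν) (hμν : (ω₁ + c) ^ 2 ≤ ν)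
    (hC₀ : 0 ≤ C₀) (hθ0 : 0 ≤ θ) (hγ : 0 < γ) (hρ0 : 0 < ρ) (hρ1 : ρ ≤ 1) (hθτρ : θ ≤ τ * ρ) (hνρτ : ν * ρ ≤ τ) (hτ0 : 0 < τ) :
    NE9 E (Window γ) κ
        (fun k i => (4 * C₀ / γ + max ℓ₂ (cb * ℓ₁ ^ 2 / (ν - ω₁ - c)) * γ / 2) / τ * τ ^ (k - i)) ∧
      FadingMemory ((4 * C₀ / γ + max ℓ₂ (cb * ℓ₁ ^ 2 / (ν - ω₁ - c)) * γ / 2) / τ) τ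
        (fun k i => (4 * C₀ / γ + max ℓ₂ (cb * ℓ₁ ^ 2 / (ν - ω₁ - c)) * γ / 2) / τ * τ ^ (k - i)) := by
  -- (L1): ROAD 1's renewal WITHOUT its smallness clause — first-order moduli `ℓ₁·(ω₁ + c)^{age}`
  have hNE1 : NE9 E (BoxWindow (Set.Ioc (0 : ℝ) γ)) κ (prodModuli ℓ₁ fun _ => ω₁ + c) :=
    ne9_of_stepLipschitz h0 hS1 (renewalSuper_geometric hℓ₁ hc hω₁ hlam fun k j hjk => (ha k j hjk).2)
  have hL1 : ∀ g ∈ Window γ, ∀ (U : Bg) (X : C.Dom) (i : ℕ), i < C.scale X → ∀ s ∈ Set.Ioc (0 : ℝ) γ, ∀ s' ∈ Set.Ioc (0 : ℝ) γ,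
      |E (Function.update g i s) U X - E (Function.update g i s') U X| ≤
        Real.exp (-(κ * C.d X)) * (ℓ₁ * (ω₁ + c) ^ (C.scale X - 1 - i) * |s - s'|) := by
    intro g hg U X i hi s hs s' hs'
    have h := coordLipschitzOn_of_ne9 hNE1 U X g hg i hi s hs s' hs'
    rwa [prodModuli_const, if_pos hi] at h
  exact ne9_and_fadingMemory_of_osc_stepSecondDiff hP hO hL1 hS2last hS2old ha hb hlam₂ hℓ₂ hc hcb hω₁ hν hμν hC₀ hθ0 hγ hρ0 hρ1 hθτρ hνρτ hτ0

end Abstract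

/-! ## §2 At the objects of record: K3's `h9` from node N18's kernel step rate + the step inequalities on the kernel functional of record -/

section AtRecord

variable (F : T4Family) (N : ℕ) [NeZero N]

open Finset in
/-- ★★★ **K3's `h9` WITH THE RECORD's MODULI FROM NODE N18's KERNEL STEP RATE + UNIFORM KERNEL DECAY + THE FIRST- AND SECOND-ORDER STEP INEQUALITIES ON THE KERNEL FUNCTIONAL OF
RECORD — NO SMALLNESS OF THE RECURSION's GROWTH.**  At a Stage-13 tuple `θ` (`0 < θ.γ`) with a letter block `ℓ` (`ℓ.Signs`): (N18) `KernelStepRateOfRecord₁₃ F N θ κ ℓ.θ₅ C₅`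
(`C₅ ≥ 0`); (1.18) `DecayBound ((objectsOfRecord₁₃ F N θ ℓ).EA 0) (Window θ.γ) E₀ κ` (`E₀ ≥ 0`); ON `E := (objectsOfRecord₁₃ F N θ ℓ).EA 0`: `StepLipschitz E (Window θ.γ) κ lam a`
(`lam ≤ ℓ₁`), (S2-last) (`lam₂ ≤ ℓ₂`), (S2-old) with channels `a`, `b`; weights `0 ≤ a k j ≤ c·ω₁^{k−j}`, `0 ≤ b k j ≤ c_b·ω₁^{k−j}`; the ROWS `ω₁ + c < ν`, `(ω₁ + c)² ≤ ν`, `1 ≤ ν`,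
`0 < ℓ.ω`, **`ℓ.θ₅·ν ≤ ℓ.ω²`**, `ℓ.κ ≤ κ`, `(4·(2C₅∕(1−ℓ.θ₅) + 2E₀)∕θ.γ + L₂·θ.γ∕2)∕ℓ.ω ≤ ℓ.C₉` (`L₂ = max ℓ₂ (c_b ℓ₁²∕(ν − ω₁ − c))`) ⟹
**`NE9 ((objectsOfRecord₁₃ F N θ ℓ).EA 0) (Window θ.γ) ℓ.κ ℓ.moduli`** — §1 at the kernel carrier with (P) by construction (J38 `prefixDependenceOn_EA`), (O) from N18's letter + the
decay (J38 `osc_EA_of_kernelStepRate_decayBound`, `C₀ = 2C₅∕(1−θ₅) + 2E₀`), `ScaleZeroFree` trivially (kernel points have scale `k + 1`), `τ := ℓ.ω`, `ρ := ℓ.ω∕ν`; then J38's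
`ne9_mono`.  The rows are jointly satisfiable with `ℓ.Signs` whenever `θ₅ν < 1`.  LOCATED (hypothesis form: the step inequalities are pub-balaban's ∕ dag-n22-a's UNPRINTED shapes,
displayed on the limiting kernels of record); N22 NOT discharged. [folklore] -/
theorem ne9_EA_objectsOfRecord₁₃_of_kernelStepRate_stepRecursion (θ : Stage13Params F N) (ℓ : U3Letters₁₁) (hs : ℓ.Signs) (hγ : 0 < θ.γ)
    {κ C₅ E₀ ℓ₁ ℓ₂ c cb ω₁ ν : ℝ} {lam lam₂ : ℕ → ℝ} {a b : ℕ → ℕ → ℝ} (hC₅ : 0 ≤ C₅) (hE₀ : 0 ≤ E₀)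
    (h5 : KernelStepRateOfRecord₁₃ F N θ κ ℓ.θ₅ C₅)
    (hdec : DecayBound ((objectsOfRecord₁₃ F N θ ℓ).EA 0) (Window θ.γ) E₀ κ)
    (hS1 : StepLipschitz ((objectsOfRecord₁₃ F N θ ℓ).EA 0) (Window θ.γ) κ lam a) (hlam : ∀ k, lam k ≤ ℓ₁) (hℓ₁ : 0 ≤ ℓ₁)
    (hS2last : ∀ g ∈ Window θ.γ, ∀ (k : ℕ) (t d : ℝ), 0 < d → t - d ∈ Set.Ioc (0 : ℝ) θ.γ → t + d ∈ Set.Ioc (0 : ℝ) θ.γ →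
      ∀ (U : PUnit) (X : ((objectsOfRecord₁₃ F N θ ℓ).levelCarriers 0).Dom), ((objectsOfRecord₁₃ F N θ ℓ).levelCarriers 0).scale X = k + 1 →
        |(objectsOfRecord₁₃ F N θ ℓ).EA 0 (Function.update g k (t + d)) U X - 2 * (objectsOfRecord₁₃ F N θ ℓ).EA 0 (Function.update g k t) U X +
            (objectsOfRecord₁₃ F N θ ℓ).EA 0 (Function.update g k (t - d)) U X| ≤
          Real.exp (-(κ * ((objectsOfRecord₁₃ F N θ ℓ).levelCarriers 0).d X)) * (lam₂ k * d ^ 2))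
    (hS2old : ∀ g ∈ Window θ.γ, ∀ (i : ℕ) (t d : ℝ), 0 < d → t - d ∈ Set.Ioc (0 : ℝ) θ.γ → t + d ∈ Set.Ioc (0 : ℝ) θ.γ →
      ∀ (D₁ D₂ : ℕ → ℝ) (k : ℕ), i < k →
        (∀ (U' : PUnit) (X' : ((objectsOfRecord₁₃ F N θ ℓ).levelCarriers 0).Dom), ((objectsOfRecord₁₃ F N θ ℓ).levelCarriers 0).scale X' ≤ k →
          |(objectsOfRecord₁₃ F N θ ℓ).EA 0 (Function.update g i (t + d)) U' X' - (objectsOfRecord₁₃ F N θ ℓ).EA 0 (Function.update g i t) U' X'| ≤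
              Real.exp (-(κ * ((objectsOfRecord₁₃ F N θ ℓ).levelCarriers 0).d X')) * D₁ (((objectsOfRecord₁₃ F N θ ℓ).levelCarriers 0).scale X') ∧
          |(objectsOfRecord₁₃ F N θ ℓ).EA 0 (Function.update g i t) U' X' - (objectsOfRecord₁₃ F N θ ℓ).EA 0 (Function.update g i (t - d)) U' X'| ≤
              Real.exp (-(κ * ((objectsOfRecord₁₃ F N θ ℓ).levelCarriers 0).d X')) * D₁ (((objectsOfRecord₁₃ F N θ ℓ).levelCarriers 0).scale X') ∧
          |(objectsOfRecord₁₃ F N θ ℓ).EA 0 (Function.update g i (t + d)) U' X' - 2 * (objectsOfRecord₁₃ F N θ ℓ).EA 0 (Function.update g i t) U' X' +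
              (objectsOfRecord₁₃ F N θ ℓ).EA 0 (Function.update g i (t - d)) U' X'| ≤
              Real.exp (-(κ * ((objectsOfRecord₁₃ F N θ ℓ).levelCarriers 0).d X')) * D₂ (((objectsOfRecord₁₃ F N θ ℓ).levelCarriers 0).scale X')) →
        ∀ (U : PUnit) (X : ((objectsOfRecord₁₃ F N θ ℓ).levelCarriers 0).Dom), ((objectsOfRecord₁₃ F N θ ℓ).levelCarriers 0).scale X = k + 1 →
          |(objectsOfRecord₁₃ F N θ ℓ).EA 0 (Function.update g i (t + d)) U X - 2 * (objectsOfRecord₁₃ F N θ ℓ).EA 0 (Function.update g i t) U X +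
              (objectsOfRecord₁₃ F N θ ℓ).EA 0 (Function.update g i (t - d)) U X| ≤
            Real.exp (-(κ * ((objectsOfRecord₁₃ F N θ ℓ).levelCarriers 0).d X)) * ∑ j ∈ range (k + 1), (a k j * D₂ j + b k j * D₁ j ^ 2))
    (ha : ∀ k j, j ≤ k → 0 ≤ a k j ∧ a k j ≤ c * ω₁ ^ (k - j)) (hb : ∀ k j, j ≤ k → 0 ≤ b k j ∧ b k j ≤ cb * ω₁ ^ (k - j))
    (hlam₂ : ∀ k, lam₂ k ≤ ℓ₂) (hℓ₂ : 0 ≤ ℓ₂) (hc : 0 ≤ c) (hcb : 0 ≤ cb) (hω₁ : 0 ≤ ω₁) (hν : ω₁ + c < ν) (hμν : (ω₁ + c) ^ 2 ≤ ν) (hν1 : 1 ≤ ν)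
    (hω : 0 < ℓ.ω) (hθω : ℓ.θ₅ * ν ≤ ℓ.ω ^ 2) (hκ : ℓ.κ ≤ κ)
    (hC₉ : (4 * (2 * C₅ / (1 - ℓ.θ₅) + 2 * E₀) / θ.γ + max ℓ₂ (cb * ℓ₁ ^ 2 / (ν - ω₁ - c)) * θ.γ / 2) / ℓ.ω ≤ ℓ.C₉) :
    NE9 ((objectsOfRecord₁₃ F N θ ℓ).EA 0) (Window θ.γ) ℓ.κ ℓ.moduli := by
  letI := θ.instVβ₁; letI := θ.instVβ₂; letI := θ.instιβ
  have hν0 : 0 < ν := lt_of_lt_of_le one_pos hν1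
  have h1θ : 0 < 1 - ℓ.θ₅ := by linarith [hs.θ₅_lt_one]
  have hC₀ : 0 ≤ 2 * C₅ / (1 - ℓ.θ₅) + 2 * E₀ := by positivity
  -- (P) by construction, (O) from node N18's letter + the decay, `ScaleZeroFree` trivially (kernel points have scale `k + 1`)
  have hP := prefixDependenceOn_EA F (mergedTermFamilyMatT F N (TβOfRecord₁₃ F N) (chiβOfRecord₁₃ F N θ) θ.εbg) θ.ρ8 θ.bV (Window θ.γ)
  have hO := osc_EA_of_kernelStepRate_decayBound F (mergedTermFamilyMatT F N (TβOfRecord₁₃ F N) (chiβOfRecord₁₃ F N θ) θ.εbg) θ.ρ8 θ.bV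
    hC₅ hs.θ₅_pos.le hs.θ₅_lt_one hE₀ h5 hdec
  have h0 : ScaleZeroFree ((objectsOfRecord₁₃ F N θ ℓ).EA 0) (Window θ.γ) :=
    fun g _ g' _ U X hX => absurd hX (Nat.succ_ne_zero _)
  -- §1 at `τ := ℓ.ω`, `ρ := ℓ.ω / ν`
  have hϱ0 : 0 < ℓ.ω / ν := div_pos hω hν0
  have hϱ1 : ℓ.ω / ν ≤ 1 := by
    rw [div_le_one hν0]
    exact hs.ω_lt_one.le.trans hν1
  have hθτϱ : ℓ.θ₅ ≤ ℓ.ω * (ℓ.ω / ν) := by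
    rw [← mul_div_assoc, ← sq, le_div_iff₀ hν0]
    exact hθω
  have hνϱτ : ν * (ℓ.ω / ν) ≤ ℓ.ω := by
    rw [mul_div_cancel₀ _ hν0.ne']
  have h := ne9_and_fadingMemory_of_osc_stepLipschitz_stepSecondDiff hP hO h0 hS1 hlam hℓ₁ hS2last hS2old ha hb hlam₂ hℓ₂ hc hcb hω₁ hν hμν hC₀
    hs.θ₅_pos.le hγ hϱ0 hϱ1 hθτϱ hνϱτ hω
  refine ne9_mono h.1 hκ (fun k i => ?_) (hs.moduli_nonneg)
  rw [U3Letters₁₁.moduli_apply]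
  exact mul_le_mul_of_nonneg_right hC₉ (pow_nonneg hs.ω_nonneg _)

/-- ★★★ **THE N22 PIN FACE IN RECURSION CURRENCY**: under K3's node-U3 pin at the tuple (`hpin`), §2's inputs at `θ.toStage13Params` give `N22At (rateCarriersOfRecord₁₃CoPH 𝔯 F θ hP g₀ os k).u3`
for EVERY run length `k` — dag-n22-w3's `n22At_rateCarriers_of_kernels_pin_of_ne9` fed with §2.  THE N22 ROW SENTENCE in this currency: «node N18's kernel step rate of record + uniform
kernel decay + the first- and second-order step inequalities of the recursion on the kernels of record with geometrically weighted channels + letter rows with `ℓ.θ₅·ν ≤ ℓ.ω²` ⇒ §2b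
`h9` ∕ `N22At` — NO smallness of the recursion's growth».  LOCATED (hypothesis form); N22 NOT discharged. [folklore] -/
theorem n22At_rateCarriers_of_kernels_pin_of_kernelStepRate_stepRecursion (𝔯 : RateReading₁₃CoPH N) (θ : Stage13HParams F N) (hP : θ.Provisos₁₃CoPH F N)
    (g₀ : ℕ → ℝ) (os : List (ULoop F)) (ℓ : U3Letters₁₁) (hs : ℓ.Signs) (hγ : 0 < θ.γ)
    (hpin : (𝔯.lit F θ hP g₀ os).u3 = objectsOfRecord₁₃ F N θ.toStage13Params ℓ)
    {κ C₅ E₀ ℓ₁ ℓ₂ c cb ω₁ ν : ℝ} {lam lam₂ : ℕ → ℝ} {a b : ℕ → ℕ → ℝ} (hC₅ : 0 ≤ C₅) (hE₀ : 0 ≤ E₀)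
    (h5 : KernelStepRateOfRecord₁₃ F N θ.toStage13Params κ ℓ.θ₅ C₅)
    (hdec : DecayBound ((objectsOfRecord₁₃ F N θ.toStage13Params ℓ).EA 0) (Window θ.γ) E₀ κ)
    (hS1 : StepLipschitz ((objectsOfRecord₁₃ F N θ.toStage13Params ℓ).EA 0) (Window θ.γ) κ lam a) (hlam : ∀ k, lam k ≤ ℓ₁) (hℓ₁ : 0 ≤ ℓ₁)
    (hS2last : ∀ g ∈ Window θ.γ, ∀ (k : ℕ) (t d : ℝ), 0 < d → t - d ∈ Set.Ioc (0 : ℝ) θ.γ → t + d ∈ Set.Ioc (0 : ℝ) θ.γ →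
      ∀ (U : PUnit) (X : ((objectsOfRecord₁₃ F N θ.toStage13Params ℓ).levelCarriers 0).Dom),
        ((objectsOfRecord₁₃ F N θ.toStage13Params ℓ).levelCarriers 0).scale X = k + 1 →
        |(objectsOfRecord₁₃ F N θ.toStage13Params ℓ).EA 0 (Function.update g k (t + d)) U X -
              2 * (objectsOfRecord₁₃ F N θ.toStage13Params ℓ).EA 0 (Function.update g k t) U X +
            (objectsOfRecord₁₃ F N θ.toStage13Params ℓ).EA 0 (Function.update g k (t - d)) U X| ≤
          Real.exp (-(κ * ((objectsOfRecord₁₃ F N θ.toStage13Params ℓ).levelCarriers 0).d X)) * (lam₂ k * d ^ 2))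
    (hS2old : ∀ g ∈ Window θ.γ, ∀ (i : ℕ) (t d : ℝ), 0 < d → t - d ∈ Set.Ioc (0 : ℝ) θ.γ → t + d ∈ Set.Ioc (0 : ℝ) θ.γ →
      ∀ (D₁ D₂ : ℕ → ℝ) (k : ℕ), i < k →
        (∀ (U' : PUnit) (X' : ((objectsOfRecord₁₃ F N θ.toStage13Params ℓ).levelCarriers 0).Dom),
          ((objectsOfRecord₁₃ F N θ.toStage13Params ℓ).levelCarriers 0).scale X' ≤ k →
          |(objectsOfRecord₁₃ F N θ.toStage13Params ℓ).EA 0 (Function.update g i (t + d)) U' X' -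
              (objectsOfRecord₁₃ F N θ.toStage13Params ℓ).EA 0 (Function.update g i t) U' X'| ≤
              Real.exp (-(κ * ((objectsOfRecord₁₃ F N θ.toStage13Params ℓ).levelCarriers 0).d X')) *
                D₁ (((objectsOfRecord₁₃ F N θ.toStage13Params ℓ).levelCarriers 0).scale X') ∧
          |(objectsOfRecord₁₃ F N θ.toStage13Params ℓ).EA 0 (Function.update g i t) U' X' -
              (objectsOfRecord₁₃ F N θ.toStage13Params ℓ).EA 0 (Function.update g i (t - d)) U' X'| ≤
              Real.exp (-(κ * ((objectsOfRecord₁₃ F N θ.toStage13Params ℓ).levelCarriers 0).d X')) *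
                D₁ (((objectsOfRecord₁₃ F N θ.toStage13Params ℓ).levelCarriers 0).scale X') ∧
          |(objectsOfRecord₁₃ F N θ.toStage13Params ℓ).EA 0 (Function.update g i (t + d)) U' X' -
                2 * (objectsOfRecord₁₃ F N θ.toStage13Params ℓ).EA 0 (Function.update g i t) U' X' +
              (objectsOfRecord₁₃ F N θ.toStage13Params ℓ).EA 0 (Function.update g i (t - d)) U' X'| ≤
              Real.exp (-(κ * ((objectsOfRecord₁₃ F N θ.toStage13Params ℓ).levelCarriers 0).d X')) *
                D₂ (((objectsOfRecord₁₃ F N θ.toStage13Params ℓ).levelCarriers 0).scale X')) →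
        ∀ (U : PUnit) (X : ((objectsOfRecord₁₃ F N θ.toStage13Params ℓ).levelCarriers 0).Dom),
          ((objectsOfRecord₁₃ F N θ.toStage13Params ℓ).levelCarriers 0).scale X = k + 1 →
          |(objectsOfRecord₁₃ F N θ.toStage13Params ℓ).EA 0 (Function.update g i (t + d)) U X -
                2 * (objectsOfRecord₁₃ F N θ.toStage13Params ℓ).EA 0 (Function.update g i t) U X +
              (objectsOfRecord₁₃ F N θ.toStage13Params ℓ).EA 0 (Function.update g i (t - d)) U X| ≤
            Real.exp (-(κ * ((objectsOfRecord₁₃ F N θ.toStage13Params ℓ).levelCarriers 0).d X)) * ∑ j ∈ Finset.range (k + 1), (a k j * D₂ j + b k j * D₁ j ^ 2))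
    (ha : ∀ k j, j ≤ k → 0 ≤ a k j ∧ a k j ≤ c * ω₁ ^ (k - j)) (hb : ∀ k j, j ≤ k → 0 ≤ b k j ∧ b k j ≤ cb * ω₁ ^ (k - j))
    (hlam₂ : ∀ k, lam₂ k ≤ ℓ₂) (hℓ₂ : 0 ≤ ℓ₂) (hc : 0 ≤ c) (hcb : 0 ≤ cb) (hω₁ : 0 ≤ ω₁) (hν : ω₁ + c < ν) (hμν : (ω₁ + c) ^ 2 ≤ ν) (hν1 : 1 ≤ ν)
    (hω : 0 < ℓ.ω) (hθω : ℓ.θ₅ * ν ≤ ℓ.ω ^ 2) (hκ : ℓ.κ ≤ κ)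
    (hC₉ : (4 * (2 * C₅ / (1 - ℓ.θ₅) + 2 * E₀) / θ.γ + max ℓ₂ (cb * ℓ₁ ^ 2 / (ν - ω₁ - c)) * θ.γ / 2) / ℓ.ω ≤ ℓ.C₉) (k : ℕ) :
    N22At (rateCarriersOfRecord₁₃CoPH 𝔯 F θ hP g₀ os k).u3 :=
  n22At_rateCarriers_of_kernels_pin_of_ne9 𝔯 θ hP g₀ os ℓ hs hpin
    (ne9_EA_objectsOfRecord₁₃_of_kernelStepRate_stepRecursion F N θ.toStage13Params ℓ hs hγ hC₅ hE₀ h5 hdec hS1 hlam hℓ₁ hS2last hS2old ha hb hlam₂ hℓ₂ hc hcb hω₁ hν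
      hμν hν1 hω hθω hκ hC₉) k

end AtRecord

end YMDAG.N22.KernelFading

end
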